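import Mathlib
import Summits.CriticalPhenomena.CardyFormulaZ2.Theorems.CardyFlipRussoSquareFromVoronoiHubDilutionDefs
import Summits.CriticalPhenomena.CardyFormulaZ2.Theorems.CardyFlipRussoSquareFromVoronoiHubFaithfulDefs
import Summits.CriticalPhenomena.CardyFormulaZ2.Theorems.CardyFlipRussoSquareFromVoronoiHubFaithfulPart4
import Summits.CriticalPhenomena.CardyFormulaZ2.Theorems.CardyFlipRussoSquareFromVoronoiHubFaithfulPart5
import Summits.CriticalPhenomena.CardyFormulaZ2.Theorems.CardyFlipRussoSquareFromVoronoiHubFaithfulPart7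
import Summits.CriticalPhenomena.CardyFormulaZ2.Theorems.CardyFlipRussoSquareFromVoronoiHubSandwichPart1
import Summits.CriticalPhenomena.CardyFormulaZ2.Theorems.CardyFlipRussoSquareFromVoronoiHubChessboardUpper
import Literature.Probability.Percolation.VoronoiCrossing
import Literature.Probability.Percolation.SitePaths
import Literature.Probability.Percolation.SitePercolationMeasure
import Literature.Probability.Percolation.CoinTranscript
import Literature.Probability.Percolation.TriHexLemma
import Literature.Probability.Percolation.RSW
import Literature.Analysis.FunctionSpaces.PoissonPointProcess
import Literature.Analysis.FunctionSpaces.PoissonPointProcessExistence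
import HarnessLib

/-!
# Stub `stub_latticeEnd_of` of line `poisson-dilution-leg`, crux `SquareFromVoronoiHub` — Part 1:
# flip symmetry, the null bad event, and the two deterministic inclusions of the lattice end

Crux `Summit.CriticalPhenomena.CardyFormulaZ2.Theses.CardyFlipRusso.SquareFromVoronoiHub`
(stmt-CriticalPhenomena-6434, route `CardyFlipRusso`; lead c5 skeleton
`Cruxes/SquareFromVoronoiHub/Lines/poisson_dilution_leg.lean`), line `poisson-dilution-leg`,
registered stub `stub_latticeEnd_of` (the lattice-end ASSEMBLY); registered sub-goal
`stub_latticeEnd_of_part1` (carrier of this Part 1).  The lattice end (`t = 0`) of the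
Poisson-dilution leg lives on `LatConfig = SiteConfig ℤ² × SiteConfig ℚ²` (fair lattice coins, fair
hub coins) with law `latMeasure`; its black region in lattice units is `latBlack θ` (closed unit
squares about the black sites minus the white-coined face centres) and the `G_s` site configuration
read off it is `gsConfig θ`.  This first part collects the four geometry/measure inputs of the
endpoint sandwich that do not involve the limit:

* `latMeasure_map_latFlip`, `latMeasure_real_preimage_latFlip` — the COLOUR FLIP `latFlip`
  (all coins complemented) preserves `latMeasure` (`Measure.map_prod_map`,
  `sitePercolation_map_compl`, `symm_half`), hence `latMeasure (latFlip ⁻¹' A) = latMeasure A` for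
  EVERY set `A` (`MeasurableEquiv.map_apply`, no measurability needed);
* `latMeasure_bad` — the bad event "one colour is missing among the lattice coins"
  (`θ.1 = ∅ ∨ θ.1 = univ`) is NULL: infinitely many fair coins are neither all closed nor all open
  (`sitePercolation_real_disjoint`, `sitePercolation_real_subset` on arbitrarily large finite sets);
* `mem_crudeCrossing_of_latBlack_path` — the LOWER INCLUSION: granted the square-chain lemma
  (hypothesis `hchain` = the registered stub `stub_latticeChain`), a continuum path in
  `closure R₁` from `R₁.arc 0` to `R₁.arc 2` inside the scaled black region `δ · latBlack θ` puts
  `gsConfig θ` in the crude event `crudeCrossing R δ`, for the lower perturbed rectangle `R₁` of K1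
  (`lowerMargins R R₁ F₀ F₂`, margin `r > δ`): verbatim the architecture of c4's
  `mem_crudeCrossing_of_blackPath_of_chain` (first entry `exists_first_entry`, collar exit
  `exists_collar_exit`, splitting `exists_mem_closure_of_split`, `exists_mem_arc_two_of_split`) with
  the shadowing constant `3/4` in place of `7/10`;
* `false_of_crudeCrossing_of_whitePath` — the UPPER EXCLUSION: granted the local no-touch lemma
  (hypothesis `htouch` = the registered stub `stub_latticeNoTouch`) and the crossing clause of
  `upperMargins R R₂` at a margin `r ≥ 2δ`, the crude event for `gsConfig θ` and a WHITE continuum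
  crossing of `R₂` (a path inside `δ · latBlack (latFlip θ)`) cannot coexist: the black polygonal
  spine of the lattice crossing (`exists_joinedIn_of_mem_crudeCrossing`) meets the white path at a
  point of a segment between two equal-or-adjacent open vertices, excluded by `htouch`.

Sources: Bollobás–Riordan, *Percolation* (2006), Ch. 5 Lemma 7 (complementation symmetry at
`p = 1/2`), Ch. 7 Lemma 14 with (19) and proof of Thm. 2 (sandwich by perturbed domains, meeting of
a black lattice crossing with a white dual crossing), Ch. 8 §8.1–8.3.
-/

noncomputable section

open scoped Topology
open MeasureTheory Metric Set Filter
open Literature.Analysis.FunctionSpaces (PointConfig IsPoissonPointProcess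
  existsUnique_isPoissonPointProcess_holds)
open Literature.Probability.Percolation (SiteConfig sitePercolation half blackRegion voronoiCrossing)
open Literature.Probability.RandomPlanarGeometry (ConformalRectangle cardyFunction crossRatio)
open Summit.CriticalPhenomena.CardyFormulaZ2.Cruxes.SquareFromVoronoiHub.VoronoiBlocks
  (zGs Gs crudeCrossing siteCrossingProb voronoiCrossingProb squareFromVoronoiHub_iff)

namespace Summit.CriticalPhenomena.CardyFormulaZ2.Cruxes.SquareFromVoronoiHub.PoissonDilutionLeg

open Literature.Probability.Percolation (PathIn sitePercolation_map_compl symm_half coe_half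
  sitePercolation_real_subset sitePercolation_real_disjoint)
open Summit.CriticalPhenomena.CardyFormulaZ2.Cruxes.SquareFromVoronoiHub.VoronoiBlocks.Faithful
  (lowerMargins exists_mem_closure_of_split exists_joinedIn_of_mem_crudeCrossing exists_first_entry
    exists_collar_exit mem_of_dist_lt_infDist_frontier exists_mem_arc_two_of_split)
open Summit.CriticalPhenomena.CardyFormulaZ2.Cruxes.SquareFromVoronoiHub.PoissonisedChessboard
  (dist_le_of_mem_segment_of_eq_or_adj)

/-! ### The colour flip preserves the lattice-end law -/

/-- The colour flip is the product of the two complementation maps. [folklore] -/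
theorem latFlip_eq_prodMap : (latFlip : LatConfig → LatConfig) = Prod.map compl compl := by
  funext θ
  rfl

/-- **The colour flip preserves the lattice-end law**: complementing all lattice coins and all
hub coins maps `latMeasure` to itself (`Measure.map_prod_map` and the complementation symmetry of
fair site percolation `sitePercolation_map_compl`, `symm_half`).
[cite: BollobasRiordan2006, Ch. 5 Lemma 7] -/
theorem latMeasure_map_latFlip : latMeasure.map latFlip = latMeasure := by
  rw [latFlip_eq_prodMap, latMeasure,
    ← Measure.map_prod_map _ _ measurable_compl measurable_compl,
    sitePercolation_map_compl, sitePercolation_map_compl, symm_half]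

/-- **Flip invariance for every event**: `latMeasure (latFlip ⁻¹' A) = latMeasure A` for EVERY
set `A`, measurable or not — the flip is a measurable equivalence preserving the law, and
`MeasurableEquiv.map_apply` is valid for all sets. [cite: BollobasRiordan2006, Ch. 5 Lemma 7] -/
theorem latMeasure_real_preimage_latFlip (A : Set LatConfig) :
    latMeasure.real (latFlip ⁻¹' A) = latMeasure.real A := by
  set Φ : LatConfig ≃ᵐ LatConfig := MeasurableEquiv.prodCongr
    (MeasurableEquiv.ofInvolutive (compl : SiteConfig (ℤ × ℤ) → _) compl_involutive
      measurable_compl)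
    (MeasurableEquiv.ofInvolutive (compl : SiteConfig (ℚ × ℚ) → _) compl_involutive
      measurable_compl)
  have hΦ : (Φ : LatConfig → LatConfig) = latFlip := by
    funext θ
    rfl
  rw [measureReal_def, measureReal_def, ← hΦ, ← MeasurableEquiv.map_apply, hΦ,
    latMeasure_map_latFlip]

/-! ### The bad event "one colour missing" is null -/

/-- The law of an event depending on the lattice coins only is its fair site-percolation
probability (a cylinder over the first factor; `Measure.prod_prod`, no measurability needed).
[folklore] -/
theorem latMeasure_fst_mem (D : Set (SiteConfig (ℤ × ℤ))) :
    latMeasure {θ : LatConfig | θ.1 ∈ D} = sitePercolation (ℤ × ℤ) half D := by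
  have h : {θ : LatConfig | θ.1 ∈ D} = D ×ˢ (univ : Set (SiteConfig (ℚ × ℚ))) := by
    ext θ
    simp
  rw [h, latMeasure, Measure.prod_prod, measure_univ, mul_one]

/-- An event of fair site percolation on `ℤ²` of probability `≤ 2⁻ⁿ` for every size `n` of a
finite set of sites is null. [folklore] -/
theorem sitePercolation_half_null_of_le_pow {S : Set (SiteConfig (ℤ × ℤ))}
    (h : ∀ F : Finset (ℤ × ℤ), (sitePercolation (ℤ × ℤ) half).real S ≤ (1 / 2 : ℝ) ^ F.card) :
    sitePercolation (ℤ × ℤ) half S = 0 := by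
  rw [← measureReal_eq_zero_iff]
  refine le_antisymm ?_ measureReal_nonneg
  by_contra hpos
  push Not at hpos
  obtain ⟨n, hn⟩ := exists_pow_lt_of_lt_one hpos (by norm_num : (1 / 2 : ℝ) < 1)
  obtain ⟨F, -, hF⟩ := (Set.infinite_univ (α := ℤ × ℤ)).exists_subset_card_eq n
  have hle := h F
  rw [hF] at hle
  exact absurd (hle.trans_lt hn) (lt_irrefl _)

/-- Infinitely many fair coins are not all closed: `P(ω = ∅) = 0`
(`P(all coins of F closed) = 2^{-|F|}`, `sitePercolation_real_disjoint`). [folklore] -/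
theorem sitePercolation_half_eq_empty : sitePercolation (ℤ × ℤ) half {ω | ω = ∅} = 0 := by
  refine sitePercolation_half_null_of_le_pow fun F => ?_
  calc (sitePercolation (ℤ × ℤ) half).real {ω | ω = ∅}
      ≤ (sitePercolation (ℤ × ℤ) half).real {ω | ∀ i ∈ F, i ∉ ω} :=
        measureReal_mono fun ω hω => by
          have hω' : ω = ∅ := hω
          simp [hω']
    _ = (1 / 2 : ℝ) ^ F.card := by
        rw [sitePercolation_real_disjoint, coe_half]
        norm_num

/-- Infinitely many fair coins are not all open: `P(ω = univ) = 0`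
(`P(all coins of F open) = 2^{-|F|}`, `sitePercolation_real_subset`). [folklore] -/
theorem sitePercolation_half_eq_univ : sitePercolation (ℤ × ℤ) half {ω | ω = univ} = 0 := by
  refine sitePercolation_half_null_of_le_pow fun F => ?_
  calc (sitePercolation (ℤ × ℤ) half).real {ω | ω = univ}
      ≤ (sitePercolation (ℤ × ℤ) half).real {ω | (↑F : Set (ℤ × ℤ)) ⊆ ω} :=
        measureReal_mono fun ω hω => by
          have hω' : ω = univ := hω
          simp [hω']
    _ = (1 / 2 : ℝ) ^ F.card := by rw [sitePercolation_real_subset, coe_half]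

/-- **The bad event is null**: under `latMeasure` almost surely both colours occur among the
lattice coins (`θ.1 ≠ ∅` and `θ.1 ≠ univ`). [folklore] -/
theorem latMeasure_bad : latMeasure {θ : LatConfig | ¬ (θ.1.Nonempty ∧ θ.1ᶜ.Nonempty)} = 0 := by
  have h : {θ : LatConfig | ¬ (θ.1.Nonempty ∧ θ.1ᶜ.Nonempty)} =
      {θ : LatConfig | θ.1 ∈ {ω : SiteConfig (ℤ × ℤ) | ω = ∅}} ∪
        {θ : LatConfig | θ.1 ∈ {ω : SiteConfig (ℤ × ℤ) | ω = univ}} := by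
    ext θ
    simp only [not_and_or, Set.not_nonempty_iff_eq_empty, Set.compl_empty_iff, mem_setOf_eq,
      mem_union]
  rw [h]
  exact measure_union_null (by rw [latMeasure_fst_mem]; exact sitePercolation_half_eq_empty)
    (by rw [latMeasure_fst_mem]; exact sitePercolation_half_eq_univ)

/-! ### The lower inclusion (given the square-chain lemma) -/

/-- **Collar sub-path shadowed by an open chain ⇒ crude crossing** (constant `3/4`).  If a
sub-path `γ|[a,b]` starts within `δ` of `(ab)`, ends within `δ` of `(cd)` and runs at distance
`≥ δ` from `∂Ω` inside `Ω`, and a `Gs`-path of `ω`-open sites, all within `3δ/4` of `γ|[a,b]`,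
joins a site within `3δ/4` of `γ(a)` to a site within `3δ/4` of `γ(b)`, then
`ω ∈ crudeCrossing R δ`: the sites are in `Ω` (`mem_of_dist_lt_infDist_frontier`, `3δ/4 < δ`) and
the endpoints are within `δ + 3δ/4 ≤ 2δ` of the arcs. [folklore] -/
theorem mem_crudeCrossing_of_collar_chain34 (R : ConformalRectangle) {δ : ℝ} (hδ : 0 < δ)
    {ω : Set ((ℤ × ℤ) ⊕ (ℤ × ℤ))} {x y : ℂ} (γ : Path x y) {a b : ℝ}
    (ha : infDist (γ.extend a) (R.arc 0) ≤ δ) (hb : infDist (γ.extend b) (R.arc 2) ≤ δ)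
    (hin : ∀ t ∈ Icc a b, γ.extend t ∈ R.carrier ∧ δ ≤ infDist (γ.extend t) (frontier R.carrier))
    {u w : (ℤ × ℤ) ⊕ (ℤ × ℤ)} (hu : dist (γ.extend a) ((δ : ℂ) * zGs u) ≤ 3 / 4 * δ)
    (hw : dist (γ.extend b) ((δ : ℂ) * zGs w) ≤ 3 / 4 * δ)
    (hpath : PathIn Gs
      ({v | ∃ t ∈ Icc a b, dist (γ.extend t) ((δ : ℂ) * zGs v) ≤ 3 / 4 * δ} ∩ ω) u w) :
    ω ∈ crudeCrossing R δ := by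
  have hsub : {v : (ℤ × ℤ) ⊕ (ℤ × ℤ) | ∃ t ∈ Icc a b,
      dist (γ.extend t) ((δ : ℂ) * zGs v) ≤ 3 / 4 * δ} ⊆
      {v | (δ : ℂ) * zGs v ∈ R.carrier} := by
    rintro v ⟨t, ht, htv⟩
    obtain ⟨hmem, hfar⟩ := hin t ht
    refine mem_of_dist_lt_infDist_frontier R.isOpen hmem ?_
    rw [dist_comm] at htv
    linarith
  refine ⟨u, w, ?_, ?_, PathIn.mem_siteConnIn (hpath.mono (inter_subset_inter_left _ hsub))⟩
  · calc infDist ((δ : ℂ) * zGs u) (R.arc 0)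
        ≤ infDist (γ.extend a) (R.arc 0) + dist ((δ : ℂ) * zGs u) (γ.extend a) :=
          infDist_le_infDist_add_dist
      _ ≤ δ + 3 / 4 * δ := add_le_add ha (by rwa [dist_comm])
      _ ≤ 2 * δ := by linarith
  · calc infDist ((δ : ℂ) * zGs w) (R.arc 2)
        ≤ infDist (γ.extend b) (R.arc 2) + dist ((δ : ℂ) * zGs w) (γ.extend b) :=
          infDist_le_infDist_add_dist
      _ ≤ δ + 3 / 4 * δ := add_le_add hb (by rwa [dist_comm])
      _ ≤ 2 * δ := by linarith

/-- **The lower inclusion of the lattice-end sandwich, deterministic part.**  ASSUME the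
square-chain lemma `hchain` (a sub-path inside the scaled black region `δ · latBlack θ` is shadowed
within `3δ/4` by a `Gs`-path of `gsConfig θ`-open vertices, endpoints within `3δ/4` of its
endpoints).  Let `r ∈ lowerMargins R R₁ F₀ F₂` with `δ < r` (closed disjoint caps `F₀`, `F₂`; `F₀`
far from `(cd)`, `F₂` from `(ab)`; the `r`-neighbourhood of `closure R₁` far from `(bc)`, `(da)`,
its off-`closure Ω` part inside `F₀ ∪ F₂`; the `r`-neighbourhoods of `R₁.arc 0`, `R₁.arc 2` off
`closure Ω` inside `F₀`, `F₂`), and let nothing be within `δ` of both `(ab)` and `(cd)`.  Then a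
continuum path `γ ⊆ closure R₁` from `R₁.arc 0` to `R₁.arc 2` inside `δ · latBlack θ` gives
`gsConfig θ ∈ crudeCrossing R δ`: `γ` starts off `closure Ω` in `F₀`, ends off `closure Ω` in `F₂`,
hence meets `(cd)` (`exists_mem_arc_two_of_split`); truncated at its first entry through `(ab)`
(`exists_first_entry`) it has a collar sub-path (`exists_collar_exit`, topological input
`exists_mem_closure_of_split`), to which `hchain` and `mem_crudeCrossing_of_collar_chain34` apply.
[cite: BollobasRiordan2006, Ch. 7 Lemma 14 with (19)] -/
theorem mem_crudeCrossing_of_latBlack_path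
    (hchain : ∀ {δ : ℝ}, 0 < δ → ∀ (θ : LatConfig) {x y : ℂ} (γ : Path x y) (a b : ℝ),
      0 ≤ a → a ≤ b → b ≤ 1 → (∀ t ∈ Icc a b, γ.extend t / (δ : ℂ) ∈ latBlack θ) →
      ∃ u w : (ℤ × ℤ) ⊕ (ℤ × ℤ), dist (γ.extend a) ((δ : ℂ) * zGs u) ≤ 3 / 4 * δ ∧
        dist (γ.extend b) ((δ : ℂ) * zGs w) ≤ 3 / 4 * δ ∧
        PathIn Gs ({v | ∃ t ∈ Icc a b, dist (γ.extend t) ((δ : ℂ) * zGs v) ≤ 3 / 4 * δ} ∩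
          gsConfig θ) u w)
    (R R₁ : ConformalRectangle) {δ : ℝ} (hδ : 0 < δ) (θ : LatConfig)
    {F₀ F₂ : Set ℂ} {r : ℝ} (hlow : r ∈ lowerMargins R R₁ F₀ F₂) (hδr : δ < r)
    (h02 : ∀ z, infDist z (R.arc 0) ≤ δ → δ < infDist z (R.arc 2))
    {x y : ℂ} (γ : Path x y) (hx : x ∈ R₁.arc 0) (hy : y ∈ R₁.arc 2)
    (hγ : ∀ t, γ t ∈ closure R₁.carrier) (hblack : ∀ t, γ t / (δ : ℂ) ∈ latBlack θ) :
    gsConfig θ ∈ crudeCrossing R δ := by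
  obtain ⟨-, hF₀, hF₂, hdisj, hA, hB, hC, hD, hE, hF⟩ := hlow
  -- (i) the cap/collar bookkeeping
  have hδr' : δ ≤ r := hδr.le
  have hr : ∀ t, infDist (γ t) (closure R₁.carrier) ≤ r := fun t => by
    rw [infDist_zero_of_mem (hγ t)]; exact hδ.le.trans hδr'
  have hout : ∀ t, γ t ∉ closure R.carrier → γ t ∈ F₀ ∪ F₂ := fun t ht => hD _ (hr t) ht
  have h₀ : ∀ z ∈ F₀, δ < infDist z (R.arc 2) := fun z hz => hδr.trans_le (hA z hz)
  have h₂ : ∀ z ∈ F₂, δ < infDist z (R.arc 0) := fun z hz => hδr.trans_le (hB z hz)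
  have h1 : ∀ t, δ < infDist (γ t) (R.arc 1) := fun t => hδr.trans_le (hC _ (hr t)).1
  have h3 : ∀ t, δ < infDist (γ t) (R.arc 3) := fun t => hδr.trans_le (hC _ (hr t)).2
  have hx' : x ∉ closure R.carrier ∧ x ∈ F₀ :=
    hE x (by rw [infDist_zero_of_mem hx]; exact hδ.le.trans hδr')
  have hy' : y ∉ closure R.carrier ∧ y ∈ F₂ :=
    hF y (by rw [infDist_zero_of_mem hy]; exact hδ.le.trans hδr')
  -- (ii) the path meets `(cd)`; truncate it at its first entry through `(ab)`
  obtain ⟨t₂, ht₂⟩ :=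
    exists_mem_arc_two_of_split R hδ γ hF₀ hF₂ hdisj hout h₂ h1 h3 hx'.2 hy'.1 hy'.2
  have ht₂' : infDist (γ t₂) (R.arc 2) ≤ δ := by rw [infDist_zero_of_mem ht₂]; exact hδ.le
  obtain ⟨t₀, ht₀0, ht₀1, harc, -, hafter⟩ :=
    exists_first_entry R hδ γ hF₀ hF₂ hdisj hout h₀ h1 h3 hx'.1 hx'.2 ⟨t₂, ht₂'⟩
  set γ' := γ.truncate t₀ 1
  have htr : ∀ s : unitInterval, ∃ t : unitInterval, γ t = γ' s := fun s =>
    γ.truncate_range (mem_range_self s)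
  have hxa : infDist (γ.extend (min t₀ 1)) (R.arc 0) ≤ δ := by
    rw [min_eq_left ht₀1, infDist_zero_of_mem harc]; exact hδ.le
  have hyb : ∃ t, infDist (γ' t) (R.arc 2) ≤ δ := by
    have ht₀t₂ : t₀ ≤ t₂ := hafter t₂ t₂.2 (by rwa [Path.extend_extends'])
    refine ⟨t₂, ?_⟩
    have : γ' t₂ = γ t₂ := by
      show γ.extend (min (max (t₂ : ℝ) t₀) 1) = γ t₂
      rw [max_eq_left ht₀t₂, min_eq_left t₂.2.2, Path.extend_extends']
    rwa [this]
  have hout' : ∀ s, γ' s ∉ closure R.carrier → γ' s ∈ F₀ ∪ F₂ := by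
    intro s hs
    obtain ⟨t, ht⟩ := htr s
    rw [← ht] at hs ⊢
    exact hout t hs
  have h1' : ∀ s, δ < infDist (γ' s) (R.arc 1) := by
    intro s; obtain ⟨t, ht⟩ := htr s; rw [← ht]; exact h1 t
  have h3' : ∀ s, δ < infDist (γ' s) (R.arc 3) := by
    intro s; obtain ⟨t, ht⟩ := htr s; rw [← ht]; exact h3 t
  -- (iii) the collar sub-path `[a, b]` of the truncated path
  obtain ⟨a, b, ha0, hab, hb1, ha, hb, hin⟩ := exists_collar_exit R hδ γ' hxa hyb
    (exists_mem_closure_of_split R γ' hF₀ hF₂ hdisj hout' h₀ h₂) h1' h3' h02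
  -- its points are points of `γ`: inside the scaled black region
  have hBt : ∀ t ∈ Icc a b, γ'.extend t / (δ : ℂ) ∈ latBlack θ := by
    intro t ht
    have ht01 : t ∈ Icc (0 : ℝ) 1 := ⟨ha0.trans ht.1, ht.2.trans hb1⟩
    obtain ⟨s, hs⟩ := htr ⟨t, ht01⟩
    rw [Path.extend_apply γ' ht01, ← hs]
    exact hblack s
  -- (iv) the chain shadowing the collar sub-path gives the crude crossing
  obtain ⟨u, w, hu, hw, hpath⟩ := hchain hδ θ γ' a b ha0 hab.le hb1 hBt
  exact mem_crudeCrossing_of_collar_chain34 R hδ γ' ha hb hin hu hw hpath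

/-! ### The upper exclusion (given the local no-touch lemma) -/

/-- Scaling a segment: a point of the segment between `δ a` and `δ b` (`δ ≠ 0`), divided by
`δ`, lies on the segment between `a` and `b`. [folklore] -/
theorem div_mem_segment_of_mem_segment_mul {δ : ℝ} (hδ : δ ≠ 0) {a b z : ℂ}
    (hz : z ∈ segment ℝ ((δ : ℂ) * a) ((δ : ℂ) * b)) : z / (δ : ℂ) ∈ segment ℝ a b := by
  obtain ⟨s, t, hs, ht, hst, rfl⟩ := hz
  refine ⟨s, t, hs, ht, hst, ?_⟩
  have hδ' : (δ : ℂ) ≠ 0 := Complex.ofReal_ne_zero.2 hδ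
  simp only [Complex.real_smul]
  field_simp

/-- **The upper exclusion of the lattice-end sandwich, deterministic part.**  ASSUME the local
no-touch lemma `htouch` (a point of the segment between two equal-or-`Gs`-adjacent OPEN vertices
of `gsConfig θ`, lattice units, is not in the white region `latBlack (latFlip θ)`), and the
crossing clause of `upperMargins R R₂` at a margin `r ≥ 2δ`.  Then `gsConfig θ ∈ crudeCrossing R δ`
and a WHITE continuum crossing `P₀ ⊆ closure R₂` of `R₂` from `R₂.arc 0` to `R₂.arc 2` (a path
inside `δ · latBlack (latFlip θ)`) cannot coexist: the black polygonal spine of the lattice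
crossing (`exists_joinedIn_of_mem_crudeCrossing`; segments between equal-or-adjacent open vertices
of `Ω`, within `δ ≤ r` of `Ω` by `dist_le_of_mem_segment_of_eq_or_adj`, from within `2δ` of `(ab)`
to within `2δ` of `(cd)`) meets `P₀` by the crossing clause, at a point `z` with `z/δ` on a
segment between two equal-or-adjacent open vertices and in `latBlack (latFlip θ)` — excluded by
`htouch`. [cite: BollobasRiordan2006, Ch. 7 proof of Thm. 2 p. 199] -/
theorem false_of_crudeCrossing_of_whitePath
    (htouch : ∀ (θ : LatConfig) (u v : (ℤ × ℤ) ⊕ (ℤ × ℤ)), u ∈ gsConfig θ → v ∈ gsConfig θ →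
      (u = v ∨ Gs.Adj u v) → ∀ z ∈ segment ℝ (zGs u) (zGs v), z ∉ latBlack (latFlip θ))
    (R R₂ : ConformalRectangle) {δ : ℝ} (hδ : 0 < δ) (θ : LatConfig) {r : ℝ}
    (hcross : ∀ (p₁ p₃ q₀ q₂ : ℂ) (P : Path p₁ p₃) (Q : Path q₀ q₂),
      infDist p₁ (R₂.arc 0) ≤ r → infDist p₃ (R₂.arc 2) ≤ r →
      (∀ t, infDist (P t) (closure R₂.carrier) ≤ r) →
      infDist q₀ (R.arc 0) ≤ r → infDist q₂ (R.arc 2) ≤ r → (∀ s, infDist (Q s) R.carrier ≤ r) →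
      ∃ t s, P t = Q s)
    (hδr : 2 * δ ≤ r) (hC : gsConfig θ ∈ crudeCrossing R δ)
    {p q : ℂ} (P₀ : Path p q) (hp : p ∈ R₂.arc 0) (hq : q ∈ R₂.arc 2)
    (hP₀ : ∀ t, P₀ t ∈ closure R₂.carrier)
    (hwhite : ∀ t, P₀ t / (δ : ℂ) ∈ latBlack (latFlip θ)) : False := by
  -- the black spine: polygonal interpolation of the open lattice crossing of `Ω`
  set Kb : Set ℂ := {z | ∃ v v' : (ℤ × ℤ) ⊕ (ℤ × ℤ), v ∈ gsConfig θ ∧ v' ∈ gsConfig θ ∧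
    (δ : ℂ) * zGs v ∈ R.carrier ∧ (v = v' ∨ Gs.Adj v v') ∧
    z ∈ segment ℝ ((δ : ℂ) * zGs v) ((δ : ℂ) * zGs v')}
  have hmemb : ∀ v ∈ gsConfig θ, (δ : ℂ) * zGs v ∈ R.carrier → (δ : ℂ) * zGs v ∈ Kb :=
    fun v hv hvΩ => ⟨v, v, hv, hv, hvΩ, Or.inl rfl, left_mem_segment ℝ _ _⟩
  have hadjb : ∀ v ∈ gsConfig θ, ∀ v' ∈ gsConfig θ, (δ : ℂ) * zGs v ∈ R.carrier →
      (δ : ℂ) * zGs v' ∈ R.carrier → Gs.Adj v v' →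
      JoinedIn Kb ((δ : ℂ) * zGs v) ((δ : ℂ) * zGs v') :=
    fun v hv v' hv' hvΩ _ hvv' =>
      JoinedIn.of_segment_subset fun z hz => ⟨v, v', hv, hv', hvΩ, Or.inr hvv', hz⟩
  obtain ⟨q₀, q₂, hq₀, hq₂, hJb⟩ := exists_joinedIn_of_mem_crudeCrossing R hC hmemb hadjb
  have hQ : ∀ s, hJb.somePath s ∈ Kb := fun s => hJb.somePath_mem s
  -- the crossing clause: the white path meets the black spine
  have hr0 : 0 ≤ r := by linarith
  obtain ⟨t, s, hts⟩ := hcross p q q₀ q₂ P₀ hJb.somePath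
    (by rw [infDist_zero_of_mem hp]; exact hr0) (by rw [infDist_zero_of_mem hq]; exact hr0)
    (fun t => by rw [infDist_zero_of_mem (hP₀ t)]; exact hr0)
    (hq₀.trans hδr) (hq₂.trans hδr)
    (fun s => by
      obtain ⟨v, v', -, -, hvΩ, hvv', hz⟩ := hQ s
      exact (infDist_le_dist_of_mem hvΩ).trans
        ((dist_le_of_mem_segment_of_eq_or_adj hδ.le hvv' hz).trans (by linarith)))
  -- the meeting point lies on a segment between two equal-or-adjacent open vertices
  obtain ⟨v, v', hv, hv', -, hvv', hz⟩ := hQ s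
  rw [← hts] at hz
  exact htouch θ v v' hv hv' hvv' _ (div_mem_segment_of_mem_segment_mul hδ.ne' hz) (hwhite t)

/-! ### Registered sub-goal -/

/-- **Registered sub-goal `stub_latticeEnd_of_part1`** of `stub_latticeEnd_of` (carrier of this
Part 1): the colour flip preserves the probability of EVERY event of the lattice end, and the
bad event "one colour missing among the lattice coins" is null.
[cite: BollobasRiordan2006, Ch. 5 Lemma 7] -/
theorem stub_latticeEnd_of_part1 : (∀ A : Set LatConfig, latMeasure.real (latFlip ⁻¹' A) = latMeasure.real A) ∧ latMeasure {θ : LatConfig | ¬ (θ.1.Nonempty ∧ θ.1ᶜ.Nonempty)} = 0 :=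
  ⟨latMeasure_real_preimage_latFlip, latMeasure_bad⟩

end Summit.CriticalPhenomena.CardyFormulaZ2.Cruxes.SquareFromVoronoiHub.PoissonDilutionLeg

end
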